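import Literature.NumberTheory.Automorphic.TruncatedKernelCompact
import Literature.Analysis.FunctionSpaces.ConvolutionFormBound

/-!
# The quadratic form of an invariant integral operator on the functions of the height is bounded by `sup h`
(Iwaniec, *Spectral Methods of Automorphic Forms*, GSM 53, §4.2 (4.12) (the principal part is an
incomplete Eisenstein series in the second variable: `L_k` acts on functions of the height by the
convolution with `g`, whose Fourier transform is the Selberg/Harish-Chandra transform `h`, (1.62));
§7.1 (the Eisenstein transform, Prop. 7.1: on the space generated by the cusps `Δ`, hence `L_k`,
acts through the continuous parameter `r` with multiplier `h(r)`); PDF pp. 51, 69–71)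

Fourth brick of the Eisenstein-free proof of the pretrace estimate (12.5)
(`Literature.NumberTheory.Automorphic.Iwaniec2002_eq_12_5`), after `CuspHeightIsometry`,
`KernelCuspAction`, `TruncatedKernelCompact`. With `Q = Σ_i V_i V_i†` the projection onto the
functions of the height above `Y` in the cusps (`Y ≥ e^{R}`, `R` the radius of the kernel) and a
real test kernel `k` with `Re 𝓕g ≤ β` (`g = selbergG k`; `𝓕g(ξ) = h(-2πξ)`, so this is
`sup_{t ∈ ℝ} Re h(t) ≤ β`), `0 ≤ β`:

1. (§1) **nice profiles are dense** in `L²((log Y, ∞))` (truncation in range and domain, dominated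
   convergence).
2. (§2) **`Re ⟨T_k Q f, Q f⟩ ≤ β ‖Q f‖²`** for every `f ∈ L²(F)` (`re_inner_kernelCLM_cuspQ_le`): on nice
   profiles `⟨T_k V_iΨ, V_iΨ⟩ = ⟨g ⋆ Ψ, Ψ⟩_{L²(ℝ)}` by the cusp action and the isometry, which is
   bounded through Plancherel (`Literature.Analysis.FunctionSpaces.re_integral_conj_mul_convolution_le`),
   the cross terms of distinct cusps vanish, and both sides are continuous.

Everything here is proved; nothing is vendored; no fact is introduced.

## References
* [Iwaniec2002] H. Iwaniec, *Spectral Methods of Automorphic Forms*, 2nd ed., GSM 53, AMS 2002,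
  §4.2 (4.12), PDF p. 51; §7.1 Prop. 7.1, PDF pp. 69–71
  (held copy `book:iwaniec2002-spectral-methods-automorphic-forms`).
-/

noncomputable section

open MeasureTheory Set Filter Real UpperHalfPlane Convolution FourierTransform
open scoped Topology MatrixGroups ComplexConjugate NNReal ENNReal Pointwise InnerProductSpace InnerProduct

namespace Literature.NumberTheory.Automorphic

namespace Fuchsian

variable {Γ : Subgroup (GL (Fin 2) ℝ)} {F : Set ℍ} {h : ℕ} {𝔞 : Fin h → OnePoint ℝ} {σ : Fin h → SL(2, ℝ)}

set_option quotPrecheck false in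
/-- `L²(F)`. -/
local notation "L2F" => Lp ℂ 2 ((volume : Measure ℍ).restrict F)

set_option quotPrecheck false in
/-- `L²((log Y, ∞))`. -/
local notation "L2Y" Y => Lp ℂ 2 ((volume : Measure ℝ).restrict (Ioi (Real.log Y)))

/-! ## 1. Nice profiles are dense in `L²((log Y, ∞))` -/

section Density

/-- The truncations of `f ∈ L²((log Y, ∞))` in range and domain are nice profiles:
`Ψ_n = 𝟙_{log Y < v ≤ n, |f v| ≤ n} f`. [folklore] -/
def niceTrunc (Y : ℝ) (f : ℝ → ℂ) (n : ℕ) (v : ℝ) : ℂ :=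
  if Real.log Y < v ∧ v ≤ n ∧ ‖f v‖ ≤ n then f v else 0

/-- The truncations are nice profiles. [folklore] -/
theorem isNiceProfile_niceTrunc (Y : ℝ) {f : ℝ → ℂ} (hf : Measurable f) (n : ℕ) :
    IsNiceProfile Y (n + 1) (niceTrunc Y f n) := by
  refine ⟨?_, ⟨n, fun v => ?_⟩, fun v hv => ?_, fun v hv => ?_⟩
  · unfold niceTrunc
    refine Measurable.ite ?_ hf measurable_const
    refine (measurableSet_lt measurable_const measurable_id).inter
      ((measurableSet_le measurable_id measurable_const).inter (measurableSet_le hf.norm measurable_const))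
  · unfold niceTrunc
    split_ifs with hv
    · exact hv.2.2
    · simp
  · unfold niceTrunc
    rw [if_neg]
    exact fun h' => absurd h'.1 (not_lt.mpr hv)
  · unfold niceTrunc
    rw [if_neg]
    intro h'
    have : (v : ℝ) ≤ n := h'.2.1
    linarith
  
/-- The truncations are dominated by `|f|` and converge to `f` pointwise on `(log Y, ∞)`. [folklore] -/
theorem norm_niceTrunc_sub_le (Y : ℝ) (f : ℝ → ℂ) (n : ℕ) (v : ℝ) : ‖niceTrunc Y f n v - f v‖ ≤ ‖f v‖ := by
  unfold niceTrunc
  split_ifs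
  · simp
  · simp

/-- Pointwise convergence of the truncations on `(log Y, ∞)`. [folklore] -/
theorem tendsto_niceTrunc {Y : ℝ} (f : ℝ → ℂ) {v : ℝ} (hv : Real.log Y < v) :
    Tendsto (fun n : ℕ => niceTrunc Y f n v) atTop (𝓝 (f v)) := by
  refine tendsto_atTop_of_eventually_const (i₀ := max ⌈v⌉₊ ⌈‖f v‖⌉₊) fun n hn => ?_
  unfold niceTrunc
  rw [if_pos]
  refine ⟨hv, ?_, ?_⟩
  · calc v ≤ ⌈v⌉₊ := Nat.le_ceil v
      _ ≤ n := by exact_mod_cast (le_max_left _ _).trans hn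
  · calc ‖f v‖ ≤ ⌈‖f v‖⌉₊ := Nat.le_ceil _
      _ ≤ n := by exact_mod_cast (le_max_right _ _).trans hn

/-- **Nice profiles are dense in `L²((log Y, ∞))`**: the classes of the truncations of a
representative converge to the class. [folklore] -/
theorem tendsto_toLp_niceTrunc {Y : ℝ} (f : Lp ℂ 2 ((volume : Measure ℝ).restrict (Ioi (Real.log Y)))) :
    Tendsto (fun n : ℕ => (isNiceProfile_niceTrunc Y (Lp.stronglyMeasurable f).measurable n).memLp.toLp
      (niceTrunc Y f n)) atTop (𝓝 f) := by
  have hfm : Measurable (f : ℝ → ℂ) := (Lp.stronglyMeasurable f).measurable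
  rw [Lp.tendsto_Lp_iff_tendsto_eLpNorm']
  -- `eLpNorm` of the difference through the Lebesgue integral of the square
  have hkey : Tendsto (fun n : ℕ => ∫⁻ v, ‖niceTrunc Y f n v - f v‖ₑ ^ 2
      ∂((volume : Measure ℝ).restrict (Ioi (Real.log Y)))) atTop (𝓝 0) := by
    have hbound : ∫⁻ v, ‖(f : ℝ → ℂ) v‖ₑ ^ 2 ∂((volume : Measure ℝ).restrict (Ioi (Real.log Y))) ≠ ⊤ :=
      lintegral_enorm_sq_ne_top_of_Lp f
    have h := tendsto_lintegral_of_dominated_convergence (μ := (volume : Measure ℝ).restrict (Ioi (Real.log Y)))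
      (F := fun (n : ℕ) v => ‖niceTrunc Y f n v - f v‖ₑ ^ 2) (f := fun _ => 0)
      (fun v => ‖(f : ℝ → ℂ) v‖ₑ ^ 2) (fun n => ?_) (fun n => ?_) hbound ?_
    · simpa using h
    · exact (((isNiceProfile_niceTrunc Y hfm n).measurable.sub hfm).enorm.pow_const 2)
    · refine Eventually.of_forall fun v => ?_
      simp only
      gcongr
      rw [← ofReal_norm, ← ofReal_norm]
      exact ENNReal.ofReal_le_ofReal (norm_niceTrunc_sub_le Y f n v)
    · rw [ae_restrict_iff' measurableSet_Ioi]
      refine Eventually.of_forall fun v hv => ?_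
      have h1 : Tendsto (fun n : ℕ => niceTrunc Y f n v - f v) atTop (𝓝 0) := by
        have := (tendsto_niceTrunc (f : ℝ → ℂ) hv).sub_const ((f : ℝ → ℂ) v)
        rwa [sub_self] at this
      have h2 : Tendsto (fun n : ℕ => ‖niceTrunc Y f n v - f v‖ₑ ^ 2) atTop (𝓝 (‖(0 : ℂ)‖ₑ ^ 2)) :=
        ENNReal.Tendsto.pow ((continuous_enorm.tendsto (0 : ℂ)).comp h1)
      rw [enorm_zero, zero_pow two_ne_zero] at h2
      exact h2
  have e : ∀ n : ℕ, eLpNorm (⇑((isNiceProfile_niceTrunc Y hfm n).memLp.toLp (niceTrunc Y f n)) - ⇑f) 2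
      ((volume : Measure ℝ).restrict (Ioi (Real.log Y))) =
      (∫⁻ v, ‖niceTrunc Y f n v - f v‖ₑ ^ 2 ∂((volume : Measure ℝ).restrict (Ioi (Real.log Y)))) ^ (1 / 2 : ℝ) := by
    intro n
    rw [eLpNorm_two_eq_lintegral_rpow]
    congr 1
    refine lintegral_congr_ae ?_
    filter_upwards [(isNiceProfile_niceTrunc Y hfm n).memLp.coeFn_toLp] with v hv
    rw [Pi.sub_apply, hv]
  simp_rw [e]
  have := (ENNReal.continuous_rpow_const (y := (1 / 2 : ℝ))).tendsto 0 |>.comp hkey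
  rw [ENNReal.zero_rpow_of_pos (by norm_num : (0 : ℝ) < 1 / 2)] at this
  exact this

end Density

/-! ## 2. The form bound `Re ⟨N Q f, Q f⟩ ≤ β ‖Q f‖²` for operators acting on the cusps by a convolution -/

section FormBound

variable (hΓ : Γ ≤ (Matrix.SpecialLinearGroup.toGL : SL(2, ℝ) →* GL (Fin 2) ℝ).range)
  (hneg : (-1 : GL (Fin 2) ℝ) ∈ Γ) (hd : IsDiscreteSubgroup Γ) (hF : IsHypFundamentalDomain Γ F)
  (hinfty : ∀ i, (Matrix.SpecialLinearGroup.toGL (σ i) : GL (Fin 2) ℝ) • (OnePoint.infty : OnePoint ℝ) = 𝔞 i)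
  (hper : ∀ i, (ConjAct.toConjAct (Matrix.SpecialLinearGroup.toGL (σ i) : GL (Fin 2) ℝ)⁻¹ • Γ).strictPeriods =
    AddSubgroup.zmultiples 1)
  (hineq : ∀ i j, ∀ γ ∈ Γ, γ • 𝔞 i = 𝔞 j → i = j)

/-- A bounded measurable function vanishing outside `(a, b)` is in `L¹ ∩ L²(ℝ)`. [folklore] -/
theorem integrable_and_memLp_of_bounded_support {Φ : ℝ → ℂ} (hΦm : Measurable Φ) {B a b : ℝ}
    (hB : ∀ v, ‖Φ v‖ ≤ B) (ha : ∀ v ≤ a, Φ v = 0) (hb : ∀ v, b ≤ v → Φ v = 0) :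
    Integrable Φ ∧ MemLp Φ 2 (volume : Measure ℝ) := by
  have hsupp : Function.support Φ ⊆ Icc a b := by
    intro v hv
    rw [Function.mem_support] at hv
    exact ⟨by by_contra h'; exact hv (ha v (not_le.mp h').le), by by_contra h'; exact hv (hb v (not_le.mp h').le)⟩
  have hint : Integrable Φ := by
    rw [← integrableOn_iff_integrable_of_support_subset hsupp]
    exact Measure.integrableOn_of_bounded (s := Icc a b) (μ := (volume : Measure ℝ)) (M := B)
      (measure_Icc_lt_top (a := a) (b := b)).ne hΦm.aestronglyMeasurable (Eventually.of_forall hB)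
  refine ⟨hint, ?_⟩
  have hB0 : 0 ≤ B := (norm_nonneg _).trans (hB 0)
  refine memLp_two_of_lintegral_enorm_sq_ne_top hΦm.aestronglyMeasurable ?_
  have h1 : ∫⁻ v, ‖Φ v‖ₑ ^ 2 ≤ ∫⁻ v, ENNReal.ofReal B * ‖Φ v‖ₑ := by
    refine lintegral_mono fun v => ?_
    rw [sq, ← ofReal_norm, ← ENNReal.ofReal_mul (norm_nonneg _), ← ENNReal.ofReal_mul hB0]
    exact ENNReal.ofReal_le_ofReal (mul_le_mul_of_nonneg_right (hB v) (norm_nonneg _))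
  refine (lt_of_le_of_lt h1 ?_).ne
  rw [lintegral_const_mul _ hΦm.enorm]
  exact ENNReal.mul_lt_top ENNReal.ofReal_lt_top hint.2

/-- A nice profile at level `Y` is nice at every level `0 < Y' ≤ Y`. [folklore] -/
theorem IsNiceProfile.of_le {Y Y' b : ℝ} {Ψ : ℝ → ℂ} (hΨ : IsNiceProfile Y b Ψ) (hY' : 0 < Y') (hY'Y : Y' ≤ Y) :
    IsNiceProfile Y' b Ψ :=
  ⟨hΨ.measurable, hΨ.bounded, fun v hv => hΨ.eq_zero_of_le v (hv.trans (Real.log_le_log hY' hY'Y)), hΨ.eq_zero_of_ge⟩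

include hΓ hneg hd hF hper in
/-- **Level change**: for a nice profile at level `Y` the cusp vectors at the levels `Y' ≤ Y` agree,
`V^{(Y)}[Ψ] = V^{(Y')}[Ψ]`. [folklore] -/
theorem cuspV_toLp_eq_of_le {Y Y' b : ℝ} (hY' : 1 ≤ Y') (hY'Y : Y' ≤ Y) {Ψ : ℝ → ℂ} (hΨ : IsNiceProfile Y b Ψ)
    (i : Fin h) :
    cuspV hΓ hneg hd hF hper (hY'.trans hY'Y) i (hΨ.memLp.toLp Ψ) =
      cuspV hΓ hneg hd hF hper hY' i ((hΨ.of_le (by linarith) hY'Y).memLp.toLp Ψ) := by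
  rw [cuspV_apply, cuspV_apply]
  refine Lp.ext ?_
  refine (cuspIsometry_toLp_coeFn hΓ hneg hd hF (σ i) (hper i) (hY'.trans hY'Y) hΨ.measurable hΨ.memLp).trans ?_
  refine Filter.EventuallyEq.trans (Eventually.of_forall fun z => ?_)
    (cuspIsometry_toLp_coeFn hΓ hneg hd hF (σ i) (hper i) hY' hΨ.measurable (hΨ.of_le (by linarith) hY'Y).memLp).symm
  unfold cuspLift
  rw [liftProfile_eq_liftProfile_zero (by linarith) hΨ.eq_zero_of_le,
    liftProfile_eq_liftProfile_zero (by linarith) (hΨ.of_le (by linarith) hY'Y).eq_zero_of_le]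

/-- The `L²((log Y, ∞))`-inner product of the classes of two nice profiles is `∫_ℝ conj Φ · Ψ`. [folklore] -/
theorem inner_toLp_nice {Y b b' : ℝ} {Φ Ψ : ℝ → ℂ} (hΦ : IsNiceProfile Y b Φ) (hΨ : IsNiceProfile Y b' Ψ) :
    ⟪hΦ.memLp.toLp Φ, hΨ.memLp.toLp Ψ⟫_ℂ = ∫ v, (starRingEnd ℂ) (Φ v) * Ψ v := by
  rw [L2.inner_def]
  have e1 : ∫ v, ⟪(hΦ.memLp.toLp Φ : ℝ → ℂ) v, (hΨ.memLp.toLp Ψ : ℝ → ℂ) v⟫_ℂ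
      ∂((volume : Measure ℝ).restrict (Ioi (Real.log Y))) =
      ∫ v in Ioi (Real.log Y), (starRingEnd ℂ) (Φ v) * Ψ v := by
    refine integral_congr_ae ?_
    filter_upwards [hΦ.memLp.coeFn_toLp, hΨ.memLp.coeFn_toLp] with v hv hv'
    rw [hv, hv', RCLike.inner_apply, mul_comm]
  rw [e1]
  refine setIntegral_eq_integral_of_forall_compl_eq_zero fun v hv => ?_
  rw [hΨ.eq_zero_of_le v (not_lt.mp hv), mul_zero]

/-- The squared norm of the class of a nice profile is `∫_ℝ ‖Ψ‖²`. [folklore] -/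
theorem norm_toLp_nice_sq {Y b : ℝ} {Ψ : ℝ → ℂ} (hΨ : IsNiceProfile Y b Ψ) :
    ‖hΨ.memLp.toLp Ψ‖ ^ 2 = ∫ v, ‖Ψ v‖ ^ 2 := by
  rw [@norm_sq_eq_re_inner ℂ, inner_toLp_nice hΨ hΨ]
  rw [show (∫ v, (starRingEnd ℂ) (Ψ v) * Ψ v) = ((∫ v, ‖Ψ v‖ ^ 2 : ℝ) : ℂ) by
    rw [← integral_complex_ofReal]
    refine integral_congr_ae (Eventually.of_forall fun v => ?_)
    show (starRingEnd ℂ) (Ψ v) * Ψ v = ((‖Ψ v‖ ^ 2 : ℝ) : ℂ)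
    rw [Complex.conj_mul', Complex.ofReal_pow]]
  exact Complex.ofReal_re _

include hΓ hneg hd hF hper in
/-- **The diagonal terms on nice profiles**: if `N V^{(Y)}[Ψ] = V^{(Y')}[G ⋆ Ψ]` with `G ⋆ Ψ` nice and
`Re 𝓕G ≤ β`, then `Re ⟨N V_𝔞[Ψ], V_𝔞[Ψ]⟩ ≤ β ‖[Ψ]‖²` (the isometry and Plancherel). [cite: Iwaniec2002, §4.2 (4.12) & §7.1 Prop. 7.1, PDF pp. 51, 69–71] -/
theorem re_inner_cuspV_le_nice {N : L2F →L[ℂ] L2F} {G : ℝ → ℂ} (hG : Integrable G) {Y Y' b b' : ℝ}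
    (hY' : 1 ≤ Y') (hY'Y : Y' ≤ Y) {β : ℝ} (hβ : ∀ ξ : ℝ, (𝓕 G ξ).re ≤ β) (i : Fin h)
    {Ψ : ℝ → ℂ} (hΨ : IsNiceProfile Y b Ψ) (hΦ : IsNiceProfile Y' b' (G ⋆[ContinuousLinearMap.mul ℂ ℂ] Ψ))
    (hact : N (cuspV hΓ hneg hd hF hper (hY'.trans hY'Y) i (hΨ.memLp.toLp Ψ)) =
      cuspV hΓ hneg hd hF hper hY' i (hΦ.memLp.toLp _)) :
    (⟪N (cuspV hΓ hneg hd hF hper (hY'.trans hY'Y) i (hΨ.memLp.toLp Ψ)),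
        cuspV hΓ hneg hd hF hper (hY'.trans hY'Y) i (hΨ.memLp.toLp Ψ)⟫_ℂ).re ≤
      β * ‖hΨ.memLp.toLp Ψ‖ ^ 2 := by
  have hΨ' := hΨ.of_le (by linarith) hY'Y
  rw [hact, cuspV_toLp_eq_of_le hΓ hneg hd hF hper hY' hY'Y hΨ i, cuspV_apply, cuspV_apply,
    LinearIsometry.inner_map_map, inner_toLp_nice hΦ hΨ', norm_toLp_nice_sq hΨ]
  obtain ⟨B, hB⟩ := hΨ.bounded
  obtain ⟨BC, hBC⟩ := hΦ.bounded
  obtain ⟨hΨ1, hΨ2⟩ := integrable_and_memLp_of_bounded_support hΨ.measurable hB hΨ.eq_zero_of_le hΨ.eq_zero_of_ge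
  obtain ⟨hC1, hC2⟩ := integrable_and_memLp_of_bounded_support hΦ.measurable hBC hΦ.eq_zero_of_le hΦ.eq_zero_of_ge
  have key := Literature.Analysis.FunctionSpaces.re_integral_conj_mul_convolution_le hG hΨ1 hΨ2 hC1 hC2 hβ
  have hswap : (∫ v, (starRingEnd ℂ) ((G ⋆[ContinuousLinearMap.mul ℂ ℂ] Ψ) v) * Ψ v).re =
      (∫ v, (starRingEnd ℂ) (Ψ v) * (G ⋆[ContinuousLinearMap.mul ℂ ℂ] Ψ) v).re := by
    have : (∫ v, (starRingEnd ℂ) ((G ⋆[ContinuousLinearMap.mul ℂ ℂ] Ψ) v) * Ψ v) =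
        (starRingEnd ℂ) (∫ v, (starRingEnd ℂ) (Ψ v) * (G ⋆[ContinuousLinearMap.mul ℂ ℂ] Ψ) v) := by
      rw [← integral_conj]
      refine integral_congr_ae (Eventually.of_forall fun v => ?_)
      simp only [map_mul, Complex.conj_conj]
      ring
    rw [this, Complex.conj_re]
  rw [hswap]
  exact key

include hΓ hneg hd hF hinfty hper hineq in
/-- **The cross terms of distinct cusps vanish on nice profiles.** [cite: Iwaniec2002, §2.2 (2.3)–(2.5) & §7.3, PDF pp. 30–31, 75] -/
theorem inner_cuspV_eq_zero_nice {N : L2F →L[ℂ] L2F} {G : ℝ → ℂ} {Y Y' b b' b'' : ℝ}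
    (hY' : 1 ≤ Y') (hY'Y : Y' ≤ Y) {i j : Fin h} (hij : i ≠ j)
    {Ψ Ψ' : ℝ → ℂ} (hΨ : IsNiceProfile Y b Ψ) (hΨ'n : IsNiceProfile Y b'' Ψ')
    (hΦ : IsNiceProfile Y' b' (G ⋆[ContinuousLinearMap.mul ℂ ℂ] Ψ))
    (hact : N (cuspV hΓ hneg hd hF hper (hY'.trans hY'Y) i (hΨ.memLp.toLp Ψ)) =
      cuspV hΓ hneg hd hF hper hY' i (hΦ.memLp.toLp _)) :
    ⟪N (cuspV hΓ hneg hd hF hper (hY'.trans hY'Y) i (hΨ.memLp.toLp Ψ)),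
      cuspV hΓ hneg hd hF hper (hY'.trans hY'Y) j (hΨ'n.memLp.toLp Ψ')⟫_ℂ = 0 := by
  rw [hact, cuspV_toLp_eq_of_le hΓ hneg hd hF hper hY' hY'Y hΨ'n j, cuspV_apply, cuspV_apply]
  exact inner_cuspIsometry_eq_zero_of_ne hΓ hneg hd hF hinfty hper hineq hij hY' _ _

include hΓ hneg hd hF hinfty hper hineq in
/-- **`Re ⟨N Q f, Q f⟩ ≤ β ‖Q f‖²`** for every `f ∈ L²(F)`, for a bounded operator `N` which maps the
cusp vectors `V_i^{(Y)}[Ψ]` of nice profiles to `V_i^{(Y')}[G ⋆ Ψ]` (`1 ≤ Y' ≤ Y`, `G ∈ L¹(ℝ)`,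
`Re 𝓕G ≤ β`): on nice profiles the diagonal terms are `⟨G ⋆ Ψ, Ψ⟩_{L²(ℝ)}`, bounded through
Plancherel, the cross terms of distinct cusps vanish, and nice profiles are dense. For `N = T_k`
this is §4.2 (4.12) with `𝓕g(ξ) = h(-2πξ)`. [cite: Iwaniec2002, §4.2 (4.12) & §7.1 Prop. 7.1, PDF pp. 51, 69–71] -/
theorem re_inner_cuspQ_le_of_cuspAction {N : L2F →L[ℂ] L2F} {G : ℝ → ℂ} (hG : Integrable G) {Y Y' : ℝ}
    (hY' : 1 ≤ Y') (hY'Y : Y' ≤ Y)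
    (hact : ∀ (i : Fin h) (b : ℝ) (Ψ : ℝ → ℂ) (hΨ : IsNiceProfile Y b Ψ),
      ∃ (b' : ℝ) (hΦ : IsNiceProfile Y' b' (G ⋆[ContinuousLinearMap.mul ℂ ℂ] Ψ)),
        N (cuspV hΓ hneg hd hF hper (hY'.trans hY'Y) i (hΨ.memLp.toLp Ψ)) =
          cuspV hΓ hneg hd hF hper hY' i (hΦ.memLp.toLp _))
    {β : ℝ} (hβ : ∀ ξ : ℝ, (𝓕 G ξ).re ≤ β) (f : L2F) :
    (⟪N (cuspQ hΓ hneg hd hF hper (hY'.trans hY'Y) f), cuspQ hΓ hneg hd hF hper (hY'.trans hY'Y) f⟫_ℂ).re ≤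
      β * ‖cuspQ hΓ hneg hd hF hper (hY'.trans hY'Y) f‖ ^ 2 := by
  have hY : 1 ≤ Y := hY'.trans hY'Y
  set V := fun i => cuspV hΓ hneg hd hF hper hY i with hV
  -- density data
  have hmeas : ∀ g : Lp ℂ 2 ((volume : Measure ℝ).restrict (Ioi (Real.log Y))), Measurable (g : ℝ → ℂ) :=
    fun g => (Lp.stronglyMeasurable g).measurable
  -- (i) the diagonal terms for arbitrary classes
  have hdiag : ∀ (i : Fin h) (g : Lp ℂ 2 ((volume : Measure ℝ).restrict (Ioi (Real.log Y)))),
      (⟪N (V i g), V i g⟫_ℂ).re ≤ β * ‖g‖ ^ 2 := by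
    intro i g
    have hlim := tendsto_toLp_niceTrunc (Y := Y) g
    have h1 : Tendsto (fun n : ℕ => (⟪N (V i ((isNiceProfile_niceTrunc Y (hmeas g) n).memLp.toLp (niceTrunc Y g n))),
        V i ((isNiceProfile_niceTrunc Y (hmeas g) n).memLp.toLp (niceTrunc Y g n))⟫_ℂ).re) atTop
        (𝓝 ((⟪N (V i g), V i g⟫_ℂ).re)) := by
      have hc : Continuous fun g' : Lp ℂ 2 ((volume : Measure ℝ).restrict (Ioi (Real.log Y))) =>
          (⟪N (V i g'), V i g'⟫_ℂ).re :=
        Complex.continuous_re.comp (Continuous.inner ((N.continuous.comp (V i).continuous)) (V i).continuous)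
      exact (hc.tendsto g).comp hlim
    have h2 : Tendsto (fun n : ℕ => β * ‖(isNiceProfile_niceTrunc Y (hmeas g) n).memLp.toLp (niceTrunc Y g n)‖ ^ 2)
        atTop (𝓝 (β * ‖g‖ ^ 2)) :=
      ((continuous_const.mul (continuous_norm.pow 2)).tendsto g).comp hlim
    refine le_of_tendsto_of_tendsto' h1 h2 fun n => ?_
    obtain ⟨b', hΦ, hact'⟩ := hact i _ _ (isNiceProfile_niceTrunc Y (hmeas g) n)
    exact re_inner_cuspV_le_nice hΓ hneg hd hF hper hG hY' hY'Y hβ i (isNiceProfile_niceTrunc Y (hmeas g) n) hΦ hact'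
  -- (ii) the cross terms for arbitrary classes
  have hcross : ∀ (i j : Fin h), i ≠ j → ∀ (g g' : Lp ℂ 2 ((volume : Measure ℝ).restrict (Ioi (Real.log Y)))),
      ⟪N (V i g), V j g'⟫_ℂ = 0 := by
    intro i j hij g g'
    -- first in `g` (with `g'` nice), then in `g'`
    have hstep : ∀ (n : ℕ), ⟪N (V i g), V j ((isNiceProfile_niceTrunc Y (hmeas g') n).memLp.toLp (niceTrunc Y g' n))⟫_ℂ = 0 := by
      intro n
      have hlim := tendsto_toLp_niceTrunc (Y := Y) g
      have hc : Continuous fun g₀ : Lp ℂ 2 ((volume : Measure ℝ).restrict (Ioi (Real.log Y))) =>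
          ⟪N (V i g₀), V j ((isNiceProfile_niceTrunc Y (hmeas g') n).memLp.toLp (niceTrunc Y g' n))⟫_ℂ :=
        Continuous.inner (N.continuous.comp (V i).continuous) continuous_const
      have h0 : Tendsto ((fun g₀ : Lp ℂ 2 ((volume : Measure ℝ).restrict (Ioi (Real.log Y))) =>
          ⟪N (V i g₀), V j ((isNiceProfile_niceTrunc Y (hmeas g') n).memLp.toLp (niceTrunc Y g' n))⟫_ℂ) ∘
          (fun m : ℕ => (isNiceProfile_niceTrunc Y (hmeas g) m).memLp.toLp (niceTrunc Y g m))) atTop (𝓝 0) := by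
        have : ((fun g₀ : Lp ℂ 2 ((volume : Measure ℝ).restrict (Ioi (Real.log Y))) =>
            ⟪N (V i g₀), V j ((isNiceProfile_niceTrunc Y (hmeas g') n).memLp.toLp (niceTrunc Y g' n))⟫_ℂ) ∘
            (fun m : ℕ => (isNiceProfile_niceTrunc Y (hmeas g) m).memLp.toLp (niceTrunc Y g m))) = fun _ => 0 := by
          funext m
          simp only [Function.comp_apply]
          obtain ⟨b', hΦ, hact'⟩ := hact i _ _ (isNiceProfile_niceTrunc Y (hmeas g) m)
          exact inner_cuspV_eq_zero_nice hΓ hneg hd hF hinfty hper hineq hY' hY'Y hij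
            (isNiceProfile_niceTrunc Y (hmeas g) m) (isNiceProfile_niceTrunc Y (hmeas g') n) hΦ hact'
        rw [this]
        exact tendsto_const_nhds
      exact tendsto_nhds_unique ((hc.tendsto g).comp hlim) h0
    have hlim := tendsto_toLp_niceTrunc (Y := Y) g'
    have hc : Continuous fun g₀ : Lp ℂ 2 ((volume : Measure ℝ).restrict (Ioi (Real.log Y))) => ⟪N (V i g), V j g₀⟫_ℂ :=
      Continuous.inner continuous_const (V j).continuous
    have h0 : Tendsto ((fun g₀ : Lp ℂ 2 ((volume : Measure ℝ).restrict (Ioi (Real.log Y))) => ⟪N (V i g), V j g₀⟫_ℂ) ∘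
        (fun n : ℕ => (isNiceProfile_niceTrunc Y (hmeas g') n).memLp.toLp (niceTrunc Y g' n))) atTop (𝓝 0) := by
      have : ((fun g₀ : Lp ℂ 2 ((volume : Measure ℝ).restrict (Ioi (Real.log Y))) => ⟪N (V i g), V j g₀⟫_ℂ) ∘
          (fun n : ℕ => (isNiceProfile_niceTrunc Y (hmeas g') n).memLp.toLp (niceTrunc Y g' n))) = fun _ => 0 :=
        funext fun n => hstep n
      rw [this]
      exact tendsto_const_nhds
    exact tendsto_nhds_unique ((hc.tendsto g').comp hlim) h0
  -- expand `Q f = Σ_i V_i (V_i† f)`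
  set g : Fin h → Lp ℂ 2 ((volume : Measure ℝ).restrict (Ioi (Real.log Y))) := fun i => ContinuousLinearMap.adjoint (V i) f with hg
  have hQ : cuspQ hΓ hneg hd hF hper hY f = ∑ i, V i (g i) := by
    rw [cuspQ_apply]
  rw [hQ, map_sum, sum_inner, Complex.re_sum]
  have hterm : ∀ i, (⟪N (V i (g i)), ∑ j, V j (g j)⟫_ℂ).re ≤ β * ‖g i‖ ^ 2 := by
    intro i
    rw [inner_sum, Complex.re_sum, Finset.sum_eq_single i (fun j _ hji => ?_) (fun h' => absurd (Finset.mem_univ i) h')]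
    · exact hdiag i (g i)
    · rw [hcross i j (Ne.symm hji), Complex.zero_re]
  refine (Finset.sum_le_sum fun i _ => hterm i).trans (le_of_eq ?_)
  rw [← Finset.mul_sum, ← hQ, norm_sq_cuspQ_apply hΓ hneg hd hF hinfty hper hineq hY f]

include hΓ hneg hd hF hper in
/-- **The cusp action of `T_k`** in the form used above: `T_k V_i^{(Y)}[Ψ] = V_i^{(Y')}[g ⋆ Ψ]` with
`g ⋆ Ψ` nice at the level `Y'`, `Y' e^{R} ≤ Y`. [cite: Iwaniec2002, §4.2 (4.12), PDF p. 51] -/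
theorem cuspAction_kernelCLM {k : ℝ → ℝ} (hk : IsTestKernel k) (hkc : Continuous k) {M : ℝ}
    (hM : ∀ u, M ≤ u → k u = 0) (hM0 : 0 ≤ M) {Y Y' : ℝ} (hY' : 1 ≤ Y')
    (hYY' : Y' * Real.exp (2 * Real.arsinh (Real.sqrt M)) ≤ Y)
    (i : Fin h) (b : ℝ) (Ψ : ℝ → ℂ) (hΨ : IsNiceProfile Y b Ψ) :
    ∃ (b' : ℝ) (hΦ : IsNiceProfile Y' b' ((fun r => ((selbergG k r : ℝ) : ℂ)) ⋆[ContinuousLinearMap.mul ℂ ℂ] Ψ)),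
      kernelCLM hΓ hneg hd hF hk hkc (cuspV hΓ hneg hd hF hper (le_trans hY' (le_trans
        (le_mul_of_one_le_right (by linarith) (Real.one_le_exp (mul_nonneg zero_le_two
          (Real.arsinh_nonneg_iff.mpr (Real.sqrt_nonneg _))))) hYY')) i (hΨ.memLp.toLp Ψ)) =
        cuspV hΓ hneg hd hF hper hY' i (hΦ.memLp.toLp _) := by
  have hconv : profileConv k Ψ = (fun r => ((selbergG k r : ℝ) : ℂ)) ⋆[ContinuousLinearMap.mul ℂ ℂ] Ψ :=
    funext fun v => integral_selbergG_mul_eq_convolution k Ψ v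
  have hΦ := hΨ.profileConv hk hM hM0 (by linarith) hYY'
  have hΦ' : IsNiceProfile Y' (b + 2 * Real.arsinh (Real.sqrt M))
      ((fun r => ((selbergG k r : ℝ) : ℂ)) ⋆[ContinuousLinearMap.mul ℂ ℂ] Ψ) := hconv ▸ hΦ
  refine ⟨_, hΦ', ?_⟩
  rw [cuspV_apply, cuspV_apply, kernelCLM_cuspIsometry hΓ hneg hd hF (σ i) (hper i) hk hkc hM hM0 hY' hYY' hΨ]
  congr 1
  exact MemLp.toLp_congr _ _ (Eventually.of_forall fun v => congrFun hconv v)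

/-- The profile `g` of a test kernel is integrable (as a complex function). [folklore] -/
theorem integrable_selbergG_ofReal {k : ℝ → ℝ} (hk : IsTestKernel k) :
    Integrable fun r => ((selbergG k r : ℝ) : ℂ) := by
  obtain ⟨Mk, hMk0, hMk⟩ := hk.eventually_zero
  obtain ⟨Bk, hBk⟩ := hk.bounded
  have := integrable_mul_selbergG_complex hk.measurable hBk hMk hMk0 (φ := fun _ => (1 : ℂ)) continuous_const
  simpa using this

/-- **`𝓕g(ξ) = h(-2πξ)`**: the Fourier transform of the profile `g` of a test kernel is its
Selberg/Harish-Chandra transform (Mathlib's `𝓕` has the character `e^{-2πiξr}`, (1.62) has `e^{irt}`).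
[cite: Iwaniec2002, (1.62), PDF p. 24] -/
theorem fourier_selbergG_eq (k : ℝ → ℝ) (ξ : ℝ) :
    𝓕 (fun r => ((selbergG k r : ℝ) : ℂ)) ξ = selbergTransform k ((-(2 * π * ξ) : ℝ) : ℂ) := by
  rw [Real.fourier_real_eq_integral_exp_smul, selbergTransform]
  refine integral_congr_ae (Eventually.of_forall fun r => ?_)
  simp only [smul_eq_mul]
  congr 1
  congr 1
  push_cast
  ring

end FormBound

end Fuchsian

end Literature.NumberTheory.Automorphic

end
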